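import Literature.Probability.LatticeModels.UrsellInversion
import HarnessLib

/-!
# The algebra of multilinear (square-free) series: convolution and the set-partition exponential

Topic `Literature/Probability/LatticeModels` (companion of `HardCoreUrsell` / `UrsellInversion`).
A function `f : Finset α → C` on the finite subsets of `α` is the coefficient list of the multilinear
("square-free") generating series `∑_Y f(Y) t^Y` in commuting variables `t_x` with `t_x² = 0`.  In this
language the moment–cumulant relation `m = ∑_π ∏ mᵀ` of `UrsellInversion` is `m = exp(mᵀ)`.  This
file records the two operations of that algebra and their basic laws, in the elementary finset form
in which they are used by the double-current cluster calculus for Ising Ursell functions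
(`UrsellMasterIdentity`, session evidence "full_proof.md" of the CamiaJiangNewman2023 unit):

* `spConv f g Y = ∑_{Z ⊆ Y} f Z · g (Y ∖ Z)` — the product of square-free series (commutative,
  associative, unit `spOne = 𝟙[· = ∅]`);
* `spExp h Y = ∑_{π ∈ setPartitions Y} ∏_{P ∈ π} h P` — the exponential (Ruelle's `Γ`, the
  "exponential formula" for set functions), with the laws `spExp (h + k) = spConv (spExp h) (spExp k)`
  (two-colouring of the blocks), `spExp 0 = spOne`, `spConv (spExp h) (spExp (-h)) = spOne`, the block
  recursion at a vertex `spExp h (insert v Y) = ∑_{Z ⊆ Y} h (insert v Z) · spExp h (Y ∖ Z)`, and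
  `spExp (ursellOf m) = m` (`m ∅ = 1`), i.e. `m = exp(mᵀ)`;
* the "diagonal collapse" identities `∑_{Z ⊆ Y} f Z f (Y∖Z) = spExp (2h) Y` for `f = spExp h` and
  `2 ∑_{Z ⊆ Y} #Z · F Z (Y∖Z) = #Y · ∑_{Z ⊆ Y} F Z (Y∖Z)` for symmetric `F`.

All statements are finite identities in a commutative ring; no new named facts.

## References

* D. Ruelle, *Statistical Mechanics: Rigorous Results* (1969), §4.4.1 (4.5)–(4.7): the algebra `𝒜`
  with the product `*`, `Γ = exp`, `Γ⁻¹ = log` [Ruelle1969].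
* R. P. Stanley, *Enumerative Combinatorics* II, §5.1 (the exponential formula) [folklore].
-/

open Finset

namespace Literature.Probability.LatticeModels

variable {α : Type*} [DecidableEq α] {C : Type*} [CommRing C]

/-! ### The square-free convolution -/

/-- The product of square-free series: `(f ⋆ g)(Y) = ∑_{Z ⊆ Y} f(Z) g(Y ∖ Z)`. [cite: Ruelle1969, §4.4.1 (4.5)] -/
def spConv (f g : Finset α → C) (Y : Finset α) : C :=
  ∑ Z ∈ Y.powerset, f Z * g (Y \ Z)

/-- The unit of the convolution: the series `1`, i.e. `𝟙[Y = ∅]`. [folklore] -/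
def spOne (Y : Finset α) : C := if Y = ∅ then 1 else 0

/-- `spOne ∅ = 1`. [folklore] -/
@[simp] theorem spOne_empty : (spOne (∅ : Finset α) : C) = 1 := if_pos rfl

/-- `spOne Y = 0` for `Y ≠ ∅`. [folklore] -/
theorem spOne_of_ne {Y : Finset α} (h : Y ≠ ∅) : (spOne Y : C) = 0 := if_neg h

/-- Commutativity of `⋆` (substitute `Z ↦ Y ∖ Z`). [folklore] -/
theorem spConv_comm (f g : Finset α → C) (Y : Finset α) : spConv f g Y = spConv g f Y := by
  unfold spConv
  refine sum_nbij' (fun Z => Y \ Z) (fun Z => Y \ Z) ?_ ?_ ?_ ?_ ?_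
  · intro Z _; exact mem_powerset.2 sdiff_subset
  · intro Z _; exact mem_powerset.2 sdiff_subset
  · intro Z hZ; exact Finset.sdiff_sdiff_eq_self (mem_powerset.1 hZ)
  · intro Z hZ; exact Finset.sdiff_sdiff_eq_self (mem_powerset.1 hZ)
  · intro Z hZ; rw [Finset.sdiff_sdiff_eq_self (mem_powerset.1 hZ), mul_comm]

/-- `spOne` is a left unit. [folklore] -/
theorem spConv_spOne_left (f : Finset α → C) (Y : Finset α) : spConv spOne f Y = f Y := by
  unfold spConv
  rw [← add_sum_erase _ _ (empty_mem_powerset Y), spOne_empty, one_mul, sdiff_empty]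
  conv_rhs => rw [← add_zero (f Y)]
  congr 1
  refine sum_eq_zero fun Z hZ => ?_
  rw [spOne_of_ne (ne_of_mem_erase hZ), zero_mul]

/-- `spOne` is a right unit. [folklore] -/
theorem spConv_spOne_right (f : Finset α → C) (Y : Finset α) : spConv f spOne Y = f Y := by
  rw [spConv_comm, spConv_spOne_left]

/-- Additivity in the first slot. [folklore] -/
theorem spConv_add_left (f₁ f₂ g : Finset α → C) (Y : Finset α) :
    spConv (f₁ + f₂) g Y = spConv f₁ g Y + spConv f₂ g Y := by
  simp only [spConv, Pi.add_apply, add_mul, sum_add_distrib]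

/-- Scalars pull out of the first slot. [folklore] -/
theorem spConv_smul_left (c : C) (f g : Finset α → C) (Y : Finset α) :
    spConv (fun Z => c * f Z) g Y = c * spConv f g Y := by
  simp only [spConv, mul_sum, mul_assoc]

/-- A set identity for the associativity of `⋆`. [folklore] -/
theorem sdiff_sdiff_sdiff_of_subset {Y Z Z₁ : Finset α} (hZ₁ : Z₁ ⊆ Z) :
    (Y \ Z₁) \ (Z \ Z₁) = Y \ Z := by
  ext u
  simp only [mem_sdiff]
  constructor
  · rintro ⟨⟨hu, hu1⟩, h2⟩
    exact ⟨hu, fun huZ => h2 ⟨huZ, hu1⟩⟩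
  · rintro ⟨hu, huZ⟩
    exact ⟨⟨hu, fun hu1 => huZ (hZ₁ hu1)⟩, fun h2 => huZ h2.1⟩

/-- Associativity of `⋆`: both iterated products are the sum over ordered triples of pairwise
disjoint sets with union `Y`. [folklore] -/
theorem spConv_assoc (f g h : Finset α → C) (Y : Finset α) :
    spConv (spConv f g) h Y = spConv f (spConv g h) Y := by
  unfold spConv
  simp_rw [sum_mul, mul_sum]
  rw [sum_sigma', sum_sigma']
  refine sum_nbij' (fun x => (⟨x.2, x.1 \ x.2⟩ : Σ _ : Finset α, Finset α))
    (fun y => (⟨y.1 ∪ y.2, y.1⟩ : Σ _ : Finset α, Finset α)) ?_ ?_ ?_ ?_ ?_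
  · rintro ⟨Z, Z₁⟩ hx
    simp only [mem_sigma, mem_powerset] at hx ⊢
    exact ⟨hx.2.trans hx.1, sdiff_subset_sdiff hx.1 le_rfl⟩
  · rintro ⟨Z₁, Z₂⟩ hy
    simp only [mem_sigma, mem_powerset] at hy ⊢
    exact ⟨union_subset hy.1 (hy.2.trans sdiff_subset), subset_union_left⟩
  · rintro ⟨Z, Z₁⟩ hx
    simp only [mem_sigma, mem_powerset] at hx
    dsimp only
    rw [union_sdiff_of_subset hx.2]
  · rintro ⟨Z₁, Z₂⟩ hy
    simp only [mem_sigma, mem_powerset] at hy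
    have hd : Disjoint Z₁ Z₂ := disjoint_of_subset_right hy.2 disjoint_sdiff
    dsimp only
    rw [union_sdiff_cancel_left hd]
  · rintro ⟨Z, Z₁⟩ hx
    simp only [mem_sigma, mem_powerset] at hx
    dsimp only
    rw [sdiff_sdiff_sdiff_of_subset hx.2, mul_assoc]

/-! ### The set-partition exponential -/

/-- The exponential of a square-free series: `(exp h)(Y) = ∑_{π ∈ setPartitions Y} ∏_{P ∈ π} h(P)`
(Ruelle's `Γ`; the value `h ∅` is never used since blocks are nonempty). [cite: Ruelle1969, §4.4.1 (4.7)] -/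
def spExp (h : Finset α → C) (Y : Finset α) : C :=
  ∑ π ∈ setPartitions Y, ∏ P ∈ π, h P

/-- `exp h ∅ = 1` (the empty set partition). [folklore] -/
@[simp] theorem spExp_empty (h : Finset α → C) : spExp h ∅ = 1 := by
  rw [spExp, setPartitions_empty, sum_singleton, prod_empty]

/-- **Unmarked decomposition.** Choosing a set partition `π` of `Y` and a sub-family `ρ ⊆ π` is the
same as choosing the union `Z` of the sub-family, a set partition `ρ` of `Z` and a set partition `κ`
of `Y ∖ Z` (`π = ρ ∪ κ`). [folklore] -/
theorem sum_setPartitions_sum_powerset {M : Type*} [AddCommMonoid M] (Y : Finset α)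
    (F : Finset (Finset α) → Finset (Finset α) → M) :
    ∑ π ∈ setPartitions Y, ∑ ρ ∈ π.powerset, F ρ (π \ ρ) =
      ∑ Z ∈ Y.powerset, ∑ ρ ∈ setPartitions Z, ∑ κ ∈ setPartitions (Y \ Z), F ρ κ := by
  rw [sum_sigma', sum_sigma']
  simp_rw [sum_sigma']
  refine sum_nbij'
    (fun x => (⟨⟨x.2.biUnion id, x.2⟩, x.1 \ x.2⟩ :
      Σ _ : (Σ _ : Finset α, Finset (Finset α)), Finset (Finset α)))
    (fun y => (⟨y.1.2 ∪ y.2, y.1.2⟩ : Σ _ : Finset (Finset α), Finset (Finset α))) ?_ ?_ ?_ ?_ ?_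
  · rintro ⟨π, ρ⟩ hx
    simp only [mem_sigma, mem_powerset, mem_setPartitions] at hx ⊢
    obtain ⟨hπ, hρπ⟩ := hx
    have hU : ρ.biUnion id ⊆ Y := fun u hu => by
      obtain ⟨Q, hQ, huQ⟩ := mem_biUnion.1 hu
      exact hπ.subset (hρπ hQ) huQ
    exact ⟨⟨hU, hπ.of_subset hρπ⟩, hπ.sdiff hρπ⟩
  · rintro ⟨⟨Z, ρ⟩, κ⟩ hy
    simp only [mem_sigma, mem_powerset, mem_setPartitions] at hy ⊢
    obtain ⟨⟨hZY, hρ⟩, hκ⟩ := hy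
    have hdisj : Disjoint Z (Y \ Z) := disjoint_sdiff
    have hun : Z ∪ (Y \ Z) = Y := union_sdiff_of_subset hZY
    exact ⟨hun ▸ hρ.union hκ hdisj, subset_union_left⟩
  · rintro ⟨π, ρ⟩ hx
    simp only [mem_sigma, mem_powerset, mem_setPartitions] at hx
    simp only [union_sdiff_of_subset hx.2]
  · rintro ⟨⟨Z, ρ⟩, κ⟩ hy
    simp only [mem_sigma, mem_powerset, mem_setPartitions] at hy
    obtain ⟨⟨hZY, hρ⟩, hκ⟩ := hy
    have hρκ : Disjoint ρ κ := hρ.disjoint_family hκ disjoint_sdiff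
    simp only [union_sdiff_cancel_left hρκ, hρ.biUnion_id]
  · rintro ⟨π, ρ⟩ hx
    rfl

/-- **The exponential law** `exp (h + k) = exp h ⋆ exp k`: colour each block of a set partition by
`h` or `k`. [cite: Ruelle1969, §4.4.1 (4.5)-(4.7)] -/
theorem spExp_add (h k : Finset α → C) (Y : Finset α) :
    spExp (h + k) Y = spConv (spExp h) (spExp k) Y := by
  unfold spExp spConv
  have hexpand : ∀ π ∈ setPartitions Y, ∏ P ∈ π, (h + k) P =
      ∑ ρ ∈ π.powerset, (∏ P ∈ ρ, h P) * ∏ P ∈ π \ ρ, k P := by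
    intro π _
    simp only [Pi.add_apply]
    rw [prod_add]
  rw [sum_congr rfl hexpand, sum_setPartitions_sum_powerset Y (fun ρ κ => (∏ P ∈ ρ, h P) * ∏ P ∈ κ, k P)]
  refine sum_congr rfl fun Z _ => ?_
  rw [sum_mul_sum]

/-- `exp 0 = 1`. [folklore] -/
theorem spExp_zero (Y : Finset α) : spExp (0 : Finset α → C) Y = spOne Y := by
  unfold spExp
  rcases Y.eq_empty_or_nonempty with rfl | hY
  · rw [setPartitions_empty, sum_singleton, prod_empty, spOne_empty]
  · rw [spOne_of_ne hY.ne_empty]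
    refine sum_eq_zero fun π hπ => ?_
    obtain ⟨P, hP, -⟩ := (mem_setPartitions.1 hπ).exists_mem hY.choose_spec
    exact prod_eq_zero hP rfl

/-- `exp h ⋆ exp (-h) = 1`: `exp (-h)` is the convolution inverse of `exp h`. [folklore] -/
theorem spConv_spExp_neg (h : Finset α → C) (Y : Finset α) :
    spConv (spExp h) (spExp (-h)) Y = spOne Y := by
  rw [← spExp_add, add_neg_cancel, spExp_zero]

/-- A set identity for the block recursion. [folklore] -/
theorem insert_sdiff_eq_sdiff_erase {v : α} {Y P₀ : Finset α} (hv : v ∉ Y) (hvP : v ∈ P₀) :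
    insert v Y \ P₀ = Y \ P₀.erase v := by
  ext u
  simp only [mem_sdiff, mem_insert, mem_erase, not_and]
  constructor
  · rintro ⟨hu | hu, huP⟩
    · exact absurd (hu ▸ hvP) huP
    · exact ⟨hu, fun _ h => absurd h huP⟩
  · rintro ⟨hu, h⟩
    have hne : u ≠ v := fun e => hv (e ▸ hu)
    exact ⟨Or.inr hu, fun huP => (h hne huP).elim⟩

/-- **Block recursion at a vertex**: for `v ∉ Y`,
`exp h (insert v Y) = ∑_{Z ⊆ Y} h (insert v Z) · exp h (Y ∖ Z)`. [folklore] -/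
theorem spExp_insert (hf : Finset α → C) {v : α} {Y : Finset α} (hv : v ∉ Y) :
    spExp hf (insert v Y) = ∑ Z ∈ Y.powerset, hf (insert v Z) * spExp hf (Y \ Z) := by
  unfold spExp
  rw [sum_setPartitions_eq_sum_block (mem_insert_self v Y)]
  have inner : ∀ P₀ ∈ (insert v Y).powerset.filter (fun P => v ∈ P),
      ∑ κ ∈ setPartitions (insert v Y \ P₀), ∏ P ∈ insert P₀ κ, hf P =
        hf P₀ * ∑ κ ∈ setPartitions (insert v Y \ P₀), ∏ P ∈ κ, hf P := by
    intro P₀ hP₀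
    rw [mul_sum]
    refine sum_congr rfl fun κ hκ => ?_
    rw [prod_insert ((mem_setPartitions.1 hκ).notMem_of_sdiff ⟨v, (mem_filter.1 hP₀).2⟩)]
  rw [sum_congr rfl inner]
  refine sum_nbij' (fun P₀ => P₀.erase v) (fun Z => insert v Z) ?_ ?_ ?_ ?_ ?_
  · intro P₀ hP₀
    obtain ⟨hsub, -⟩ := mem_filter.1 hP₀
    rw [mem_powerset] at hsub ⊢
    intro u hu
    obtain ⟨hne, huP⟩ := mem_erase.1 hu
    exact (mem_insert.1 (hsub huP)).resolve_left hne
  · intro Z hZ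
    rw [mem_powerset] at hZ
    exact mem_filter.2 ⟨mem_powerset.2 (insert_subset_insert v hZ), mem_insert_self v Z⟩
  · intro P₀ hP₀; exact insert_erase (mem_filter.1 hP₀).2
  · intro Z hZ
    rw [mem_powerset] at hZ
    exact erase_insert fun h => hv (hZ h)
  · intro P₀ hP₀
    have hvP : v ∈ P₀ := (mem_filter.1 hP₀).2
    rw [insert_erase hvP, insert_sdiff_eq_sdiff_erase hv hvP]

/-- `exp (mᵀ) = m` for a moment function with `m ∅ = 1` (the cluster decomposition of
`UrsellInversion`, `m(V) = ∑_π ∏ mᵀ`). [cite: Ruelle1969, §4.4.1 (4.7)] -/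
theorem spExp_ursellOf (m : Finset α → C) (hm0 : m ∅ = 1) (Y : Finset α) :
    spExp (ursellOf m) Y = m Y := by
  rcases Y.eq_empty_or_nonempty with rfl | hY
  · rw [spExp_empty, hm0]
  · exact sum_setPartitions_prod_ursellOf m hY

/-! ### Diagonal collapse identities -/

/-- `∑_{Z ⊆ Y} exp h (Z) exp h (Y ∖ Z) = exp (2h) (Y)`. [folklore] -/
theorem sum_powerset_spExp_mul_spExp (h : Finset α → C) (Y : Finset α) :
    ∑ Z ∈ Y.powerset, spExp h Z * spExp h (Y \ Z) = spExp (h + h) Y := by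
  rw [spExp_add]; rfl

/-- For a symmetric kernel, `2 ∑_{Z ⊆ Y} #Z · F(Z, Y∖Z) = #Y · ∑_{Z ⊆ Y} F(Z, Y∖Z)`. [folklore] -/
theorem two_mul_sum_card_mul (F : Finset α → Finset α → C) (Y : Finset α)
    (hF : ∀ Z ⊆ Y, F Z (Y \ Z) = F (Y \ Z) Z) :
    2 * ∑ Z ∈ Y.powerset, (Z.card : C) * F Z (Y \ Z) = (Y.card : C) * ∑ Z ∈ Y.powerset, F Z (Y \ Z) := by
  have hflip : ∑ Z ∈ Y.powerset, (Z.card : C) * F Z (Y \ Z) =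
      ∑ Z ∈ Y.powerset, ((Y \ Z).card : C) * F Z (Y \ Z) := by
    refine sum_nbij' (fun Z => Y \ Z) (fun Z => Y \ Z) ?_ ?_ ?_ ?_ ?_
    · intro Z _; exact mem_powerset.2 sdiff_subset
    · intro Z _; exact mem_powerset.2 sdiff_subset
    · intro Z hZ; exact Finset.sdiff_sdiff_eq_self (mem_powerset.1 hZ)
    · intro Z hZ; exact Finset.sdiff_sdiff_eq_self (mem_powerset.1 hZ)
    · intro Z hZ
      rw [Finset.sdiff_sdiff_eq_self (mem_powerset.1 hZ), ← hF Z (mem_powerset.1 hZ)]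
  rw [two_mul]
  conv_lhs => rw [hflip]; arg 1; rw [← hflip]
  rw [← sum_add_distrib, mul_sum]
  refine sum_congr rfl fun Z hZ => ?_
  rw [← add_mul, ← Nat.cast_add, add_comm, card_sdiff_add_card_eq_card (mem_powerset.1 hZ)]

end Literature.Probability.LatticeModels
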